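import Mathlib
import Literature.Probability.Percolation.CriticalOneArmBKLowerBound
import Literature.Probability.Percolation.SharpnessDCTProofs
import Literature.Probability.Percolation.PercolationProofs
import HarnessLib

/-!
# `stub_bkSplit` of line `registered` (crux `BoxGluing`, stmt-CriticalPhenomena-4643):
# localisation of the two-point function by the van den Berg–Kesten inequality

Registered stub `stub_bkSplit` of the lead's skeleton `Cruxes/BoxGluing/Lines/birth.lean`
(reshape r2) of the route `PercHyperscalingGluing`: for bond percolation on `ℤ³` at
`p_c = criticalProbI 3`, all `K n : ℕ` and every `x ∈ Λ_n = box 3 n`,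

  `P(0 ↔ x) ≤ P(0 ↔ x inside Λ_{(K+1)n}) + P(0 ↔ ∂Λ_{Kn})²`.

Proof (van den Berg–Kesten on two disjoint arms, the argument of the tree's
`Literature.Probability.Percolation.real_openConnIn_box_le_oneArmProb_sq`): almost surely
`ω ⊆ E(ℤ³)` (`DCT16.real_mono_of_forall_subset_edgeSet`); if `0 ↔ x` in `ω` but not inside
`Λ_{(K+1)n}`, an open PATH `p` from `0` to `x` (a walk of the open graph, made simple by
`SimpleGraph.Walk.bypass`) visits a vertex `u ∉ Λ_{(K+1)n}`; the prefix `p.takeUntil u` leaves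
`Λ_{Kn} ∋ 0` and its initial segment up to the first exit (`exists_firstExit_edges`) witnesses
`{0 ↔ ∂Λ_{Kn}} = siteToBoundary 3 (K n)`; the reversed suffix `(p.dropUntil u).reverse` runs from
`x` to `u ∉ x + Λ_{Kn}` (`‖u - x‖_∞ ≥ (K+1)n + 1 - n > Kn`, `BkSplit.sub_not_mem_box`) and its
initial segment up to the first exit from `x + Λ_{Kn}` witnesses the translated arm event
`DCT16.armEvent x (K n)`; prefix and suffix of a path are edge-disjoint
(`SimpleGraph.Walk.IsTrail.disjoint_edges_takeUntil_dropUntil`), so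
`ω ∈ siteToBoundary 3 (Kn) □ DCT16.armEvent x (Kn)` (`IsUpperSet.mem_disjointOccurrence_iff`);
finally `P(A ∪ B) ≤ P(A) + P(B)`, BK for finitary increasing events (`bk_finitary`) and translation
invariance (`DCT16.real_armEvent`) give the bound `π_{Kn}²` for the second event.

No new definitions; the two helpers (pure lattice geometry / path surgery, every dimension `d`)
live in the sub-namespace `BkSplit`.
-/

noncomputable section

namespace Summit.CriticalPhenomena.PercolationContinuityZ3.Theorems

open MeasureTheory ProbabilityTheory
open Literature.Probability.Percolation Literature.Probability.LatticeModels
open Literature.Probability.Percolation.DCT16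
open scoped Literature.Probability.Percolation

namespace BkSplit

variable {d : ℕ}

/-- Geometry of boxes: if `x ∈ Λ_n`, `u ∉ Λ_M` and `m + n ≤ M`, then `u - x ∉ Λ_m`
(some coordinate of `u` exceeds `M` in absolute value, the same coordinate of `x` is at most `n`).
[folklore] -/
theorem sub_not_mem_box {n m M : ℕ} (hM : m + n ≤ M) {x u : Site d} (hx : x ∈ box d n)
    (hu : u ∉ box d M) : u - x ∉ box d m := by
  intro hux
  apply hu
  rw [mem_box] at hx hux ⊢
  intro i
  have h1 := hx i
  have h2 := hux i
  simp only [Pi.sub_apply] at h2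
  have hM' : (m : ℤ) + n ≤ M := by exact_mod_cast hM
  constructor <;> omega

/-- **One open connection leaving a box yields two disjoint arms.** For a lattice configuration
`ω ⊆ E(ℤ^d)`: if `0 ↔ x` in `ω` with `x ∈ Λ_n`, but not inside `Λ_M`, and `m + n ≤ M`, then the arm
events `{0 ↔ ∂Λ_m in Λ_m}` and `{x ↔ x + ∂Λ_m in x + Λ_m}` occur on disjoint sets of open edges:
split an open path from `0` to `x` at a vertex `u ∉ Λ_M`; the prefix, cut at its first exit from
`Λ_m`, and the reversed suffix, cut at its first exit from `x + Λ_m` (`u - x ∉ Λ_m`), are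
edge-disjoint witnesses. [folklore] -/
theorem mem_disjointOccurrence_of_openConn {n m M : ℕ} (hM : m + n ≤ M) {x : Site d}
    (hx : x ∈ box d n) {ω : BondConfig (Site d)} (hω : ω ⊆ (zdGraph d).edgeSet)
    (h : ω ∈ openConn 0 x) (h' : ω ∉ openConnIn (↑(box d M) : Set (Site d)) 0 x) :
    ω ∈ siteToBoundary d m □ DCT16.armEvent x m := by
  classical
  have hreach : (openGraph ω).Reachable 0 x := h
  obtain ⟨p₀⟩ := hreach
  -- an open PATH from `0` to `x`
  set p : (openGraph ω).Walk 0 x := p₀.bypass with hp_def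
  have hp : p.IsPath := p₀.bypass_isPath
  -- some vertex of `p` lies outside `Λ_M`
  have hout : ∃ u ∈ p.support, u ∉ (↑(box d M) : Set (Site d)) := by
    by_contra hall
    push Not at hall
    exact h' (mem_openConnIn_of_walk p hall fun e he =>
      edgeSet_openGraph_subset ω (p.edges_subset_edgeSet he))
  obtain ⟨u, hu, huM⟩ := hout
  -- split `p` at `u` into two edge-disjoint pieces
  set q₁ : (openGraph ω).Walk 0 u := p.takeUntil u hu with hq₁
  set q₂ : (openGraph ω).Walk u x := p.dropUntil u hu with hq₂
  have hdisj₁₂ : q₁.edges.Disjoint q₂.edges := hp.isTrail.disjoint_edges_takeUntil_dropUntil hu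
  -- first exit of the prefix from `Λ_m`
  have hmM : m ≤ M := le_trans (Nat.le_add_right m n) hM
  have h0 : (0 : Site d) ∈ (↑(box d m) : Set (Site d)) := Finset.mem_coe.2 (zero_mem_box d m)
  have hum : u ∉ (↑(box d m) : Set (Site d)) := fun hu' =>
    huM (Finset.mem_coe.2 (box_mono d hmM (Finset.mem_coe.1 hu')))
  obtain ⟨a, b, q, hab, ha, hb, hq, hqe⟩ :=
    exists_firstExit_edges (↑(box d m) : Set (Site d)) q₁ h0 hum
  -- first exit of the reversed suffix from `x + Λ_m`
  set Bx : Set (Site d) := {w | w - x ∈ box d m} with hBx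
  have hxBx : x ∈ Bx := by
    show x - x ∈ box d m
    rw [sub_self]
    exact zero_mem_box d m
  have huBx : u ∉ Bx := sub_not_mem_box hM hx fun h'' => huM (Finset.mem_coe.2 h'')
  obtain ⟨a', b', q', hab', ha', hb', hq', hqe'⟩ := exists_firstExit_edges Bx q₂.reverse hxBx huBx
  -- the two witnesses
  set K : Set (Sym2 (Site d)) := {e | e ∈ q.edges} with hK
  set L : Set (Sym2 (Site d)) := {e | e ∈ q'.edges} with hL
  have hKω : K ⊆ ω := fun e he => edgeSet_openGraph_subset ω (q.edges_subset_edgeSet he)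
  have hLω : L ⊆ ω := fun e he => edgeSet_openGraph_subset ω (q'.edges_subset_edgeSet he)
  have hdisj : Disjoint K L := by
    rw [Set.disjoint_left]
    intro e heK heL
    have h1 : e ∈ q₁.edges := hqe e heK
    have h2 : e ∈ q₂.edges := by
      have := hqe' e heL
      rwa [SimpleGraph.Walk.edges_reverse, List.mem_reverse] at this
    exact hdisj₁₂ h1 h2
  have hKA : K ∈ siteToBoundary d m := by
    refine ⟨a, mem_innerBoundary_iff.2 ⟨Finset.mem_coe.1 ha, b, fun h'' => hb (Finset.mem_coe.2 h''),
      adj_of_openGraph_adj hω hab⟩, mem_openConnIn_of_walk q hq fun e he => he⟩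
  have hLB : L ∈ DCT16.armEvent x m := by
    refine ⟨a', mem_innerBoundary_iff.2 ⟨ha', b' - x, hb', ?_⟩,
      mem_openConnIn_of_walk q' hq' fun e he => he⟩
    rw [DCT16.zdGraph_adj_sub_iff]
    exact adj_of_openGraph_adj hω hab'
  exact ((isUpperSet_siteToBoundary d m).mem_disjointOccurrence_iff
    (isUpperSet_armEvent_translate x m) ω).2 ⟨K, hKω, L, hLω, hdisj, hKA, hLB⟩

end BkSplit

/-- **Stub 2a of `Cruxes/BoxGluing/Lines/birth.lean` — BK SPLIT (localisation by van den
Berg–Kesten).** For all `K n : ℕ` and `x ∈ Λ_n`: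
`P_{p_c}(0 ↔ x) ≤ P_{p_c}(0 ↔ x inside Λ_{(K+1)n}) + P_{p_c}(0 ↔ ∂Λ_{Kn})²` for bond percolation on
`ℤ³` at `p_c = criticalProbI 3`: a.s. `ω ⊆ E(ℤ³)`, and on `{0 ↔ x} ∖ {0 ↔ x in Λ_{(K+1)n}}` the two
arm events `{0 ↔ ∂Λ_{Kn}}`, `{x ↔ x + ∂Λ_{Kn} in x + Λ_{Kn}}` occur disjointly
(`BkSplit.mem_disjointOccurrence_of_openConn` with `M = (K+1)n = Kn + n`), whence the bound by
subadditivity, BK (`bk_finitary`) and translation invariance (`DCT16.real_armEvent`). -/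
theorem stub_bkSplit :
    ∀ K n : ℕ, ∀ x ∈ box 3 n,
      (bondPercolation (zdGraph 3) (criticalProbI 3)).real (openConn 0 x) ≤
        (bondPercolation (zdGraph 3) (criticalProbI 3)).real (openConnIn ↑(box 3 ((K + 1) * n)) 0 x) +
          (bondPercolation (zdGraph 3) (criticalProbI 3)).real (siteToBoundary 3 (K * n)) ^ 2 := by
  classical
  intro K n x hx
  have hKn : K * n + n ≤ (K + 1) * n := (add_one_mul K n).symm.le
  calc (bondPercolation (zdGraph 3) (criticalProbI 3)).real (openConn 0 x)
      ≤ (bondPercolation (zdGraph 3) (criticalProbI 3)).real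
          (openConnIn (↑(box 3 ((K + 1) * n)) : Set (Site 3)) 0 x ∪
            (siteToBoundary 3 (K * n) □ DCT16.armEvent x (K * n))) :=
        real_mono_of_forall_subset_edgeSet (zdGraph 3) _ fun ω hω h => by
          by_cases h' : ω ∈ openConnIn (↑(box 3 ((K + 1) * n)) : Set (Site 3)) 0 x
          · exact Or.inl h'
          · exact Or.inr (BkSplit.mem_disjointOccurrence_of_openConn hKn hx hω h h')
    _ ≤ (bondPercolation (zdGraph 3) (criticalProbI 3)).real
            (openConnIn (↑(box 3 ((K + 1) * n)) : Set (Site 3)) 0 x) +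
          (bondPercolation (zdGraph 3) (criticalProbI 3)).real
            (siteToBoundary 3 (K * n) □ DCT16.armEvent x (K * n)) :=
        measureReal_union_le _ _
    _ ≤ (bondPercolation (zdGraph 3) (criticalProbI 3)).real
            (openConnIn (↑(box 3 ((K + 1) * n)) : Set (Site 3)) 0 x) +
          (bondPercolation (zdGraph 3) (criticalProbI 3)).real (siteToBoundary 3 (K * n)) *
            (bondPercolation (zdGraph 3) (criticalProbI 3)).real (DCT16.armEvent x (K * n)) := by
        gcongr
        exact bk_finitary (zdGraph 3) _ (isUpperSet_siteToBoundary 3 (K * n))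
          (isUpperSet_armEvent_translate x (K * n)) (isFinitary_siteToBoundary 3 (K * n))
          (isFinitary_armEvent_translate x (K * n))
    _ = (bondPercolation (zdGraph 3) (criticalProbI 3)).real
            (openConnIn (↑(box 3 ((K + 1) * n)) : Set (Site 3)) 0 x) +
          (bondPercolation (zdGraph 3) (criticalProbI 3)).real (siteToBoundary 3 (K * n)) ^ 2 := by
        rw [DCT16.real_armEvent, sq]

end Summit.CriticalPhenomena.PercolationContinuityZ3.Theorems

end
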